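import Summits.BirchSwinnertonDyer.Rank1Residual.Additive.KatoDescentStrictSelmerCount
import Summits.BirchSwinnertonDyer.Rank1Residual.Additive.KatoDescentRankOneCountFineLattice
import Summits.BirchSwinnertonDyer.Rank1Residual.Additive.KatoDescentIntegralH1RankOne
import Summits.BirchSwinnertonDyer.Rank1Residual.Additive.KatoDescentIntegralH1Index
import Summits.BirchSwinnertonDyer.Rank1Residual.X12.O11.LocalKernelFiniteAtThreeDischarge
import Summits.BirchSwinnertonDyer.Rank1Residual.X11b.BDPRouteSelmerCountLemmas
import Literature.NumberTheory.EllipticCurves.BSDSelmerParityDokchitserBaseChangeProofs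
import Literature.NumberTheory.EllipticCurves.IwasawaLeadingTermProofs
import Literature.NumberTheory.EllipticCurves.MordellWeilTheoremProofs
import Literature.NumberTheory.DiophantineGeometry.LocalReductionFiniteBadPlacesProofs
import HarnessLib

set_option autoImplicit false

/-!
# `KatoH2CountAt` VERSUS THE COUNTING DISPLAY OF STUB 3: ON THE ROWS the H²-side count (14.14.2) + (14.9.3) is pinned to
# `#Sel_str · #W(ℚ_p)[p^∞]` and its valuation to `v_p #Ш[p^∞] + v_p Tam + v(log_ω P) − a`; COUNT-H2 ⟺ COUNT-EC⁰ on the all-additive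
# rows (seat `bsd-cm-prr-ty1` g12, cell `bsd-cm`; theorems only: no definition, no named fact, no instance, no `sorry`)

Part 32 of the seat's kernel cut of stub 3 `stub_rankOneCountReadingKato` of the Kato–Perrin-Riou skeletons v4 (cruxes
stmt-BirchSwinnertonDyer-19945 / -19223); plan (α)-I of planner D512 (3) / D514 (2) / D519 / D529: the ONE comparison
«`Kato2004.KatoH2CountAt W p #(𝐇²_Γ)` (`n · #W(ℚ)[p^∞] = #Sel_str · #W(ℚ_p)[p^∞]`, H2X⁺'s reading of (14.14.2) + (14.9.3)) ⟷ the
counting display of stub 3», H²-side count DISPLAYED.  Inputs: Part 31b `finite_katoStrictSelmer_and_padicValNat_card_eq` (strict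
Selmer count on the rows), E9 `KatoDescentH2CoinvariantsFineSelmer` (COUNT-EC⁰ ⟸ COUNT-FINE⁰), E11 (`v₀ = a + v(log_ω P)`).
* §1 helpers: finite subgroups of `H¹(K, E[p^∞])` and finite modules over a `ℤ_p`-algebra have `p`-power order; `p ∤ #E(K)_tors ⟹
  #E(K)[p^∞] = 1`; the finite set `Σ` of bad places `≠ v_p` on an all-additive row; rank one ⟹ a generator modulo torsion.
* §2 ON THE ROWS (Part 31b's hypotheses; J-free): `katoH2CountAt_iff_eq_mul` (`KatoH2CountAt W p n ↔ n = #Sel_str · #W(ℚ_p)[p^∞]`),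
  `padicValNat_add_eq_of_katoH2CountAt` (`⟹ v_p n + a = v_p #Ш[p^∞] + v_p Tam + v(log_ω P)`) and, for `n` a power of `p`,
  **`katoH2CountAt_iff_padicValNat_add_eq`** (`⟺`).
* §3 the display **COUNT-H2** := «∀ all-additive rows `(W, p, κ, γ, I, J)` with the (H2ᶜ) pin, `KatoH2CountAt W p #(J.H2)_Γ`»
  (COUNT-EC⁰'s binders + «every bad `ℓ ≠ p` additive»; the phrasing closest to print) and **`countEC₀_additive_of_gzk_of_countH2`**
  ({GZK} + COUNT-H2 ⟹ COUNT-EC⁰ on the all-additive rows: E9's display verbatim + the one extra binder),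
  **`countH2_of_gzk_of_thm12_4_of_countEC₀`** ({GZK, `thm12_4`} + COUNT-EC⁰ ⟹ COUNT-H2).  So, modulo {GZK, `thm12_4`}, COUNT-H2 ⟺
  COUNT-EC⁰ ⟸ COUNT-FINE⁰ ⟸ COUNT-FINEᵃ (E9, Part 20) on the all-additive rows (every CM row); COUNT-FINE⁰ stays the display of
  record (D481 / D519 (iv)); COUNT-H2 is the named sufficient input upstream of COUNT-EC⁰, stated in the currency a rank-one
  H2X⁺ (guard `Finite (katoStrictSelmer W p {v})` in place of `Finite W(ℚ)`) speaks — `KatoH2CountAt W p #(J.H2)_Γ` for ITS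
  package `J ⊇ X₀`; carrying that count to every (H2ᶜ)-pinned `J` is E9's J-elimination (pointer; not done here).
HONEST LABEL: theorems only; no stub or item is closed; nothing is registered; nothing is asserted on 19945 / 19223; rows with a
multiplicative `ℓ ≠ p` are NOT covered ((R1-d)-mult, D514); Kato's Main Conjecture and Perrin-Riou's conjecture are not touched;
BSD is not proved for any curve.  References: [Kato2004Asterisque] Thm. 12.4 (p. 221), (14.9.3) (p. 240), §14.14 (p. 243),
Lemma 14.15, Prop. 14.16, §14.18 (p. 244); [GreenbergLNM1716] §2–§4; [BlochKato1990] Ex. 3.11; [GrossZagier1986] Thm. I.7.3;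
[SilvermanAEC2009] VII.3, VIII.1 Rem. 1.3, Thm. VIII.6.7; [MilneADT2006] I Cor. 2.3.
-/

noncomputable section

open scoped Classical NumberField ContRepresentation

open WeierstrassCurve Field IsDedekindDomain NumberField CategoryTheory Literature.NumberTheory.EllipticCurves
  Literature.NumberTheory.EllipticCurves.Kato2004 Literature.NumberTheory.GaloisRepresentations
  Literature.NumberTheory.GaloisRepresentations.DiscreteGaloisModule Literature.NumberTheory.EllipticCurves.Kato2004.EulerSystemValues
  Literature.NumberTheory.EllipticCurves.IwasawaAlgebra Literature.NumberTheory.EllipticCurves.Rank1Residual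
open WeierstrassCurve (galH1Primary kummerMapTorsion)
open Summit.BirchSwinnertonDyer.Rank1Residual.X12.O11 Summit.BirchSwinnertonDyer.Rank1Residual
  Summit.BirchSwinnertonDyer.Rank1Residual.Additive.GlobalKummer
  Summit.BirchSwinnertonDyer.BirchSwinnertonDyer.Theorems.CongruentShaFreeCutKatoKummerLogTorsion

namespace Summit.BirchSwinnertonDyer.Rank1Residual.Additive.StrictCount

/-! ## §1 `p`-power orders; `#W(ℚ)[p^∞] = 1` on the rows; the set `Σ` of bad places `≠ v_p` -/

section PPower

variable {K : Type} [Field K] [NumberField K] (W : WeierstrassCurve K) [W.IsElliptic] (p : ℕ) [hp : Fact p.Prime]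

omit [W.IsElliptic] in
/-- **A finite subgroup of `H¹(K, E[p^∞])` has `p`-power order**: every class of `H¹(K, E[p^∞])` is killed by a power of
`p` (`exists_pow_nsmul_eq_zero_galH1Primary`), so a finite subgroup is a `p`-group (`IsPGroup.iff_card`). [folklore]
[cite: GreenbergLNM1716, §2 (p. 62)] -/
theorem exists_natCard_addSubgroup_galH1Primary_eq_pow (S : AddSubgroup (galH1Primary W p)) [Finite S] :
    ∃ k : ℕ, Nat.card S = p ^ k := by
  have hP : IsPGroup p (Multiplicative S) := fun g => by
    obtain ⟨k, hk⟩ := exists_pow_nsmul_eq_zero_galH1Primary W p ((Multiplicative.toAdd g : S) : galH1Primary W p)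
    refine ⟨k, Multiplicative.toAdd.injective ?_⟩
    rw [toAdd_pow, toAdd_one]
    exact Subtype.ext (by rw [AddSubmonoidClass.coe_nsmul, hk, ZeroMemClass.coe_zero])
  obtain ⟨k, hk⟩ := IsPGroup.iff_card.mp hP
  exact ⟨k, hk⟩

/-- **`p ∤ #E(K)_tors ⟹ #E(K)[p^∞] = 1`**: the `p`-primary component of `E(K)` is that of the finite torsion subgroup
(`natCard_primaryComponent_point_eq_torsion`), a `p`-group (X11b `exists_natCard_primaryComponent_eq_pow_of_finite`) whose order
divides `#E(K)_tors`. [cite: SilvermanAEC2009, VII.3 and VIII.7] -/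
theorem natCard_primaryComponent_point_eq_one_of_not_dvd_torsionOrder (h : ¬ p ∣ W.torsionOrder) :
    Nat.card (AddCommGroup.primaryComponent W.toAffine.Point p) = 1 := by
  haveI : Finite (AddCommGroup.torsion W.toAffine.Point) := W.finite_torsion_holds
  rw [natCard_primaryComponent_point_eq_torsion W p]
  obtain ⟨k, hk⟩ :=
    X11b.SelmerCount.exists_natCard_primaryComponent_eq_pow_of_finite p (G := AddCommGroup.torsion W.toAffine.Point)
  have hdvd : p ^ k ∣ W.torsionOrder := by
    rw [← hk]; exact AddSubgroup.card_addSubgroup_dvd_card _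
  rcases k with _ | k
  · rw [hk, pow_zero]
  · exact absurd (dvd_trans (dvd_pow_self p (Nat.succ_ne_zero k)) hdvd) h

end PPower

section PPowerModule

variable (p : ℕ) [hp : Fact p.Prime]

/-- **A finite module over a `ℤ_p`-algebra has `p`-power order**: for `m ∈ M`, `#M • m = 0` and `#M = p^v u` with `p ∤ u`,
`u` a unit of `ℤ_p`, so `p^v • m = 0` — `M` is a `p`-group.  Used for `#(𝐇²_Γ)`, a finite `Λ`-module. [folklore] -/
theorem exists_natCard_eq_pow_of_module {R M : Type*} [CommRing R] [Algebra ℤ_[p] R] [AddCommGroup M] [Module R M]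
    [Finite M] : ∃ k : ℕ, Nat.card M = p ^ k := by
  have hp' : p.Prime := hp.out
  obtain ⟨v, u, hu, hN⟩ := Nat.exists_eq_pow_mul_and_not_dvd (Nat.card_pos (α := M)).ne' p hp'.ne_one
  have hunit : IsUnit ((u : ℕ) : R) := by
    have h1 : IsUnit ((u : ℕ) : ℤ_[p]) := by
      rw [PadicInt.isUnit_iff]
      refine le_antisymm (PadicInt.norm_le_one _) (not_lt.mp fun hlt => hu ?_)
      have h := (PadicInt.norm_int_lt_one_iff_dvd (u : ℤ)).mp (by exact_mod_cast hlt)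
      exact Int.natCast_dvd_natCast.mp h
    simpa using h1.map (algebraMap ℤ_[p] R)
  have hP : IsPGroup p (Multiplicative M) := fun g => by
    refine ⟨v, Multiplicative.toAdd.injective ?_⟩
    rw [toAdd_pow, toAdd_one]
    set m := Multiplicative.toAdd g
    have hNm : Nat.card M • m = 0 := addOrderOf_dvd_iff_nsmul_eq_zero.mp (addOrderOf_dvd_natCard m)
    obtain ⟨w, hw⟩ := hunit
    have h1 : ((p ^ v * u : ℕ) : R) • m = 0 := by rw [← hN, Nat.cast_smul_eq_nsmul]; exact hNm
    have h2 : (w : R) • ((p ^ v : ℕ) : R) • m = 0 := by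
      rw [hw, ← mul_smul, mul_comm, ← Nat.cast_mul]; exact h1
    have h3 : ((p ^ v : ℕ) : R) • m = 0 := by
      have := congrArg ((↑w⁻¹ : R) • ·) h2
      simpa only [← mul_smul, Units.inv_mul_cancel_left, smul_zero] using this
    rw [← Nat.cast_smul_eq_nsmul R, h3]
  obtain ⟨k, hk⟩ := IsPGroup.iff_card.mp hP
  exact ⟨k, hk⟩

end PPowerModule

section BadPlaces

variable (W : WeierstrassCurve ℚ) [W.IsElliptic] (p : ℕ)

/-- **The finite set `Σ` of bad places `≠ v_p`** (`WeierstrassCurve.finite_badPlaces_holds`): on an ALL-ADDITIVE row (every bad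
`ℓ ≠ p` additive) it satisfies the three side conditions `hQp`, `hQadd`, `hQbad` of Parts 30/31. [cite: SilvermanAEC2009, VIII.1 Remark 1.3] -/
theorem exists_finset_badPlaces_ne
    (hall : ∀ v ∈ W.badPlaces (𝓞 ℚ), ((Rat.HeightOneSpectrum.primesEquiv v : Nat.Primes) : ℕ) ≠ p → W.HasAdditiveReductionAt v) :
    ∃ Q : Finset (HeightOneSpectrum (𝓞 ℚ)),
      (∀ v ∈ Q, ((Rat.HeightOneSpectrum.primesEquiv v : Nat.Primes) : ℕ) ≠ p) ∧
      (∀ v ∈ Q, W.HasAdditiveReductionAt v) ∧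
      (∀ v : HeightOneSpectrum (𝓞 ℚ), v ∈ W.badPlaces (𝓞 ℚ) →
        ((Rat.HeightOneSpectrum.primesEquiv v : Nat.Primes) : ℕ) ≠ p → v ∈ Q) := by
  have hfin : (W.badPlaces (𝓞 ℚ)).Finite := WeierstrassCurve.finite_badPlaces_holds (A := 𝓞 ℚ) W
  refine ⟨hfin.toFinset.filter (fun v => ((Rat.HeightOneSpectrum.primesEquiv v : Nat.Primes) : ℕ) ≠ p),
    fun v hv => (Finset.mem_filter.mp hv).2, fun v hv => ?_, fun v hv hne => ?_⟩
  · obtain ⟨hv1, hv2⟩ := Finset.mem_filter.mp hv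
    exact hall v (hfin.mem_toFinset.mp hv1) hv2
  · exact Finset.mem_filter.mpr ⟨hfin.mem_toFinset.mpr hv, hne⟩

end BadPlaces

section Generator

variable {K : Type*} [Field K] [NumberField K] (W : WeierstrassCurve K) [W.IsElliptic]

/-- **Rank one ⟹ a generator modulo torsion**: for `rank_ℤ E(K) = 1` some `P ∈ E(K)` generates `E(K)/E(K)_tors`
(the Mordell–Weil basis `exists_isMordellWeilBasis_holds` has one element). [cite: SilvermanAEC2009, Thm. VIII.6.7] -/
theorem exists_generates_modTorsion_of_mordellWeilRank_eq_one (hr1 : W.mordellWeilRank = 1) :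
    ∃ P : W.toAffine.Point, ∀ Q : W.toAffine.Point, ∃ n : ℤ, IsOfFinAddOrder (Q - n • P) := by
  obtain ⟨B, hB⟩ := W.exists_isMordellWeilBasis_holds
  haveI : Subsingleton (Fin W.mordellWeilRank) := by rw [hr1]; infer_instance
  let i₀ : Fin W.mordellWeilRank := ⟨0, by omega⟩
  have hrange : Set.range (QuotientAddGroup.mk ∘ B : Fin W.mordellWeilRank → mordellWeilModTorsion W) =
      {QuotientAddGroup.mk (B i₀)} := by
    ext z
    simp only [Set.mem_range, Set.mem_singleton_iff, Function.comp_apply]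
    exact ⟨by rintro ⟨i, rfl⟩; rw [Subsingleton.elim i i₀], by rintro rfl; exact ⟨i₀, rfl⟩⟩
  refine ⟨B i₀, fun Q => ?_⟩
  have hQ : (QuotientAddGroup.mk Q : mordellWeilModTorsion W) ∈
      Submodule.span ℤ (Set.range (QuotientAddGroup.mk ∘ B : Fin W.mordellWeilRank → mordellWeilModTorsion W)) := by
    rw [hB.2]; trivial
  rw [hrange, Submodule.mem_span_singleton] at hQ
  obtain ⟨a, ha⟩ := hQ
  refine ⟨a, ?_⟩
  have h0 : (QuotientAddGroup.mk (Q - a • B i₀) : mordellWeilModTorsion W) = 0 := by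
    rw [QuotientAddGroup.mk_sub, QuotientAddGroup.mk_zsmul, ha, sub_self]
  exact (AddCommGroup.mem_torsion _).mp ((QuotientAddGroup.eq_zero_iff _).mp h0)

end Generator

/-! ## §2 `KatoH2CountAt` ON THE ROWS: `n` is pinned to `#Sel_str · #W(ℚ_p)[p^∞]`, `v_p n` to `v_p #Ш[p^∞] + v_p Tam + v(log_ω P) − a` -/

section Rows

variable (W : WeierstrassCurve ℚ) [W.IsElliptic] [W.IsGloballyMinimal] (p : ℕ) [hp : Fact p.Prime]
  [ContinuousSMul ℤ_[p] (W.tateModule p)]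

omit [W.IsGloballyMinimal] [ContinuousSMul ℤ_[p] (W.tateModule p)] in
/-- **`KatoH2CountAt W p n ↔ n = #Sel_str · #W(ℚ_{v_p})[p^∞]`** as soon as `p ∤ #W(ℚ)_tors` (then `#W(ℚ)[p^∞] = 1`): the
predicate pins `n`. [cite: Kato2004Asterisque, (14.9.3) (p. 240) and (14.14.2) (p. 243)] -/
theorem katoH2CountAt_iff_eq_mul (htors : ¬ p ∣ W.torsionOrder) (n : ℕ) :
    KatoH2CountAt W p n ↔
      n = Nat.card (katoStrictSelmer W p {primePlace p}) *
        Nat.card (AddCommGroup.primaryComponent (W.baseChange ((primePlace p).adicCompletion ℚ)).toAffine.Point p) := by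
  -- (§1 is stated over a general number field with the classical `DecidableEq`; `convert` bridges the instance on `W(ℚ)`)
  have h1 : Nat.card (AddCommGroup.primaryComponent W.toAffine.Point p) = 1 := by
    convert natCard_primaryComponent_point_eq_one_of_not_dvd_torsionOrder W p htors
  rw [katoH2CountAt_iff, h1, mul_one]

/-- **`KatoH2CountAt W p n` ⟹ `v_p n + a = v_p #Ш[p^∞] + v_p Tam + v(log_ω P)` ON THE ROWS** (`W/ℚ` globally minimal, `p` odd,
`Addv W p`, rank one generated by `P` modulo torsion, `Ш[p^∞]` finite, `p ∤ #W(ℚ)_tors`, `x = κ_∞(P)`, `H¹(ℤ[1/p],T_pW) =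
ℤ_p ∙ p^a x`, `Σ` = additive places `≠ p` ⊇ bad `≠ p`): `n = #Sel_str · #W(ℚ_p)[p^∞]` (`katoH2CountAt_iff_eq_mul`) and Part 31b
`finite_katoStrictSelmer_and_padicValNat_card_eq`. [cite: Kato2004Asterisque, (14.9.3) (p. 240), (14.14.2) (p. 243), Prop. 14.16 (p. 244)] -/
theorem padicValNat_add_eq_of_katoH2CountAt (hodd : p ≠ 2) (hadd : Addv W p) (hrank : W.mordellWeilRank = 1)
    (hsha : Finite (AddCommGroup.primaryComponent W.sha p)) (htors : ¬ p ∣ W.torsionOrder) {P : W.toAffine.Point}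
    (hgen : ∀ R : W.toAffine.Point, ∃ n : ℤ, IsOfFinAddOrder (R - n • P)) {x : H1 (tateRep W p) ⊤}
    (hx : ∀ j : ℕ,
      (ofTopSubgroup (W.torsionGaloisModule ((p : ℤ) ^ j)).toTopRep 1).hom (reduceH1Pk W p j ⊤ x) =
        kummerMapTorsion W ((p : ℤ) ^ j) (zsmul_pow_surjective W p j) P)
    (Q : Finset (HeightOneSpectrum (𝓞 ℚ)))
    (hQp : ∀ v ∈ Q, ((Rat.HeightOneSpectrum.primesEquiv v : Nat.Primes) : ℕ) ≠ p)
    (hQadd : ∀ v ∈ Q, W.HasAdditiveReductionAt v)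
    (hQbad : ∀ v : HeightOneSpectrum (𝓞 ℚ), v ∈ W.badPlaces (𝓞 ℚ) →
      ((Rat.HeightOneSpectrum.primesEquiv v : Nat.Primes) : ℕ) ≠ p → v ∈ Q)
    {a : ℕ} (ha : integralH1 (tateRep W p) p ⊤ = ℤ_[p] ∙ (p ^ a • x)) {n : ℕ} (hn : KatoH2CountAt W p n) :
    (padicValNat p n : ℤ) + a =
      padicValNat p (Nat.card (AddCommGroup.primaryComponent W.sha p)) + padicValNat p W.tamagawaProduct +
        (padicLogLocal W p (Affine.Point.map (W' := W.toAffine) (S := ℚ) (Algebra.ofId ℚ ℚ_[p]) P)).valuation := by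
  obtain ⟨hfin, heq⟩ :=
    finite_katoStrictSelmer_and_padicValNat_card_eq W p hodd hadd hrank hsha htors hgen hx Q hQp hQadd hQbad ha
  haveI := hfin
  haveI := finite_primaryComponent_point_adicCompletion W p (primePlace p)
  rw [katoH2CountAt_iff_eq_mul W p htors] at hn
  rw [hn, padicValNat.mul Nat.card_pos.ne' Nat.card_pos.ne', Nat.cast_add]
  exact heq

/-- **`KatoH2CountAt W p n ↔ v_p n + a = v_p #Ш[p^∞] + v_p Tam + v(log_ω P)` ON THE ROWS, for `n` a power of `p`**
(`#Sel_str` and `#W(ℚ_p)[p^∞]` are powers of `p`: `exists_natCard_addSubgroup_galH1Primary_eq_pow`, X11b for the `p`-primary component).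
The pointwise form of the comparison «H²-side count (14.14.2)+(14.9.3) ⟷ counting display of stub 3» (plan (α)-I).
[cite: Kato2004Asterisque, (14.9.3) (p. 240), (14.14.2) (p. 243), Prop. 14.16 (p. 244)] [cite: GreenbergLNM1716, §2–§4] -/
theorem katoH2CountAt_iff_padicValNat_add_eq (hodd : p ≠ 2) (hadd : Addv W p) (hrank : W.mordellWeilRank = 1)
    (hsha : Finite (AddCommGroup.primaryComponent W.sha p)) (htors : ¬ p ∣ W.torsionOrder) {P : W.toAffine.Point}
    (hgen : ∀ R : W.toAffine.Point, ∃ n : ℤ, IsOfFinAddOrder (R - n • P)) {x : H1 (tateRep W p) ⊤}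
    (hx : ∀ j : ℕ,
      (ofTopSubgroup (W.torsionGaloisModule ((p : ℤ) ^ j)).toTopRep 1).hom (reduceH1Pk W p j ⊤ x) =
        kummerMapTorsion W ((p : ℤ) ^ j) (zsmul_pow_surjective W p j) P)
    (Q : Finset (HeightOneSpectrum (𝓞 ℚ)))
    (hQp : ∀ v ∈ Q, ((Rat.HeightOneSpectrum.primesEquiv v : Nat.Primes) : ℕ) ≠ p)
    (hQadd : ∀ v ∈ Q, W.HasAdditiveReductionAt v)
    (hQbad : ∀ v : HeightOneSpectrum (𝓞 ℚ), v ∈ W.badPlaces (𝓞 ℚ) →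
      ((Rat.HeightOneSpectrum.primesEquiv v : Nat.Primes) : ℕ) ≠ p → v ∈ Q)
    {a : ℕ} (ha : integralH1 (tateRep W p) p ⊤ = ℤ_[p] ∙ (p ^ a • x)) {n : ℕ} (hn : ∃ k : ℕ, n = p ^ k) :
    KatoH2CountAt W p n ↔
      (padicValNat p n : ℤ) + a =
        padicValNat p (Nat.card (AddCommGroup.primaryComponent W.sha p)) + padicValNat p W.tamagawaProduct +
          (padicLogLocal W p (Affine.Point.map (W' := W.toAffine) (S := ℚ) (Algebra.ofId ℚ ℚ_[p]) P)).valuation := by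
  refine ⟨padicValNat_add_eq_of_katoH2CountAt W p hodd hadd hrank hsha htors hgen hx Q hQp hQadd hQbad ha, fun h => ?_⟩
  obtain ⟨hfin, heq⟩ :=
    finite_katoStrictSelmer_and_padicValNat_card_eq W p hodd hadd hrank hsha htors hgen hx Q hQp hQadd hQbad ha
  haveI := hfin
  haveI := finite_primaryComponent_point_adicCompletion W p (primePlace p)
  obtain ⟨k, rfl⟩ := hn
  obtain ⟨i, hi⟩ := exists_natCard_addSubgroup_galH1Primary_eq_pow W p (katoStrictSelmer W p {primePlace p})
  obtain ⟨j, hj⟩ := X11b.SelmerCount.exists_natCard_primaryComponent_eq_pow_of_finite p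
    (G := (W.baseChange ((primePlace p).adicCompletion ℚ)).toAffine.Point)
  rw [katoH2CountAt_iff_eq_mul W p htors, hi, hj, ← pow_add]
  rw [hi, hj, padicValNat.prime_pow, padicValNat.prime_pow] at heq
  rw [padicValNat.prime_pow] at h
  rw [show k = i + j by exact_mod_cast (by linarith : (k : ℤ) = i + j)]

end Rows

/-! ## §3 The display COUNT-H2 and COUNT-EC⁰ ON THE ALL-ADDITIVE ROWS: each implies the other modulo {GZK, `thm12_4`} -/

section Displays

open Summit.BirchSwinnertonDyer.Rank1Residual.Additive.LocPKummer

/-- **COUNT-EC⁰ ON THE ALL-ADDITIVE ROWS ⟸ {GZK} + COUNT-H2.**  COUNT-H2 (hypothesis `hH2`) is the display «for `W/ℚ` globally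
minimal of analytic rank one, `p` odd, `Addv W p`, `0 ≤ v_p(j)`, `p ∤ #W(ℚ)_tors`, `Ш` finite, EVERY BAD `ℓ ≠ p` ADDITIVE, the
cyclotomic datum `(κ, γ)`, a (12.2.1) pin `I` and a Kato H²-package `J` pinned to `X₀(E/ℚ_∞)` by (H2ᶜ): `KatoH2CountAt W p
#(J.H2)_Γ`» ((14.14.2) `H²(ℤ[1/p], T_pW) ≅ (𝐇²)_Γ` read through (14.9.3)).  The conclusion is E9's display COUNT-EC⁰ VERBATIM
with the one extra binder «every bad `ℓ ≠ p` additive» (exact on the CM rows).  GZK gives rank one; E11 gives `a` with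
`v₀ = a + v(log_ω P)`; §2 with `Σ` from `exists_finset_badPlaces_ne`. [cite: Kato2004Asterisque, (14.9.3) (p. 240), §14.14
(14.14.1)–(14.14.2) (p. 243), Lemma 14.15 and Prop. 14.16 (p. 244)] [cite: BlochKato1990, Ex. 3.11] [cite: GrossZagier1986, Thm. I.7.3] -/
theorem countEC₀_additive_of_gzk_of_countH2 (hGZK : rank_eq_analyticRank_of_analyticRank_le_one)
    (hH2 : ∀ (W : WeierstrassCurve ℚ) [W.IsElliptic] [W.IsGloballyMinimal] (p : ℕ) [Fact p.Prime],
      letI : ContinuousSMul ℤ_[p] (W.tateModule p) := TateModule.continuousSMul_padicInt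
      ∀ (κ : ZpExtension ℚ p) (γ : absoluteGaloisGroup ℚ), κ.IsCyclotomic → κ.IsTopGenerator γ →
        ∀ (I : IwasawaH1Data W p κ γ) (J : IwasawaH2Data W p κ γ I),
          W.analyticRank = 1 → p ≠ 2 → Addv W p → 0 ≤ padicValRat p W.j → ¬ p ∣ W.torsionOrder → Finite W.sha →
          (∀ v ∈ W.badPlaces (𝓞 ℚ), ((Rat.HeightOneSpectrum.primesEquiv v : Nat.Primes) : ℕ) ≠ p →
            W.HasAdditiveReductionAt v) →
          (∀ (Y : W.FineSelmerDualData κ γ⁻¹) (𝔮 : PrimeSpectrum (IwasawaAlgebra p)), 𝔮.asIdeal.height = 1 →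
            Module.lengthAt (IwasawaAlgebra p) J.H2 𝔮 = Module.lengthAt (IwasawaAlgebra p) Y.X 𝔮) →
          KatoH2CountAt W p (Nat.card (coinvariants p J.H2))) :
    ∀ (W : WeierstrassCurve ℚ) [W.IsElliptic] [W.IsGloballyMinimal] (p : ℕ) [Fact p.Prime],
      letI : ContinuousSMul ℤ_[p] (W.tateModule p) := TateModule.continuousSMul_padicInt
      ∀ (κ : ZpExtension ℚ p) (γ : absoluteGaloisGroup ℚ), κ.IsCyclotomic → κ.IsTopGenerator γ →
        ∀ (I : IwasawaH1Data W p κ γ) (J : IwasawaH2Data W p κ γ I) (P : W.toAffine.Point)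
          (φ : integralH1 (tateRep W p) p (κ.layerSubgroup 0) →ₗ[ℤ_[p]] ℚ_[p]) (v₀ : ℤ),
          W.analyticRank = 1 → p ≠ 2 → Addv W p → 0 ≤ padicValRat p W.j → ¬ p ∣ W.torsionOrder →
          Finite W.sha →
          (∀ v ∈ W.badPlaces (𝓞 ℚ), ((Rat.HeightOneSpectrum.primesEquiv v : Nat.Primes) : ℕ) ≠ p →
            W.HasAdditiveReductionAt v) →
          (∀ (Y : W.FineSelmerDualData κ γ⁻¹) (𝔮 : PrimeSpectrum (IwasawaAlgebra p)), 𝔮.asIdeal.height = 1 →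
            Module.lengthAt (IwasawaAlgebra p) J.H2 𝔮 = Module.lengthAt (IwasawaAlgebra p) Y.X 𝔮) →
          (∀ Q : W.toAffine.Point, ∃ n : ℤ, IsOfFinAddOrder (Q - n • P)) →
          (∀ x : integralH1 (tateRep W p) p (κ.layerSubgroup 0),
            HasLocPKummerLog W p (layerZeroToTop W p κ (x : H1 (tateRep W p) (κ.layerSubgroup 0))) (φ x)) →
          LinearMap.range φ = Submodule.span ℤ_[p] {((p : ℚ_[p]) ^ v₀)} →
          (padicValNat p (Nat.card (coinvariants p J.H2)) : ℤ) + v₀ =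
            padicValNat p (Nat.card (AddCommGroup.primaryComponent W.sha p)) + padicValNat p W.tamagawaProduct +
              2 * (padicLogLocal W p
                (WeierstrassCurve.Affine.Point.map (W' := W.toAffine) (S := ℚ) (Algebra.ofId ℚ ℚ_[p]) P)).valuation := by
  intro W _ _ p _
  letI : ContinuousSMul ℤ_[p] (W.tateModule p) := TateModule.continuousSMul_padicInt
  intro κ γ hκ hγ I J P φ v₀ hr hp2 hadd hj htors hsha hall hpin hP hφ hv₀
  obtain ⟨hmw, -⟩ := hGZK W (by rw [hr])
  have hrank : W.mordellWeilRank = 1 := by rw [hmw, hr]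
  haveI := hsha
  have hsha' : Finite (AddCommGroup.primaryComponent W.sha p) := inferInstance
  obtain ⟨x, hx⟩ := exists_forall_ofTopSubgroup_reduceH1Pk_eq_kummerMapTorsion W p (zsmul_pow_surjective W p) P
  obtain ⟨a, ha, hv₀a⟩ := exists_integralH1_eq_span_pow_smul_and_eq_add_valuation W p κ hrank hsha' htors hP hx φ hφ hv₀
  obtain ⟨Q, hQp, hQadd, hQbad⟩ := exists_finset_badPlaces_ne W p hall
  have h := padicValNat_add_eq_of_katoH2CountAt W p hp2 hadd hrank hsha' htors hP hx Q hQp hQadd hQbad ha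
    (hH2 W p κ γ hκ hγ I J hr hp2 hadd hj htors hsha hall hpin)
  rw [hv₀a]
  linarith

/-- **COUNT-H2 ⟸ {GZK, `Kato2004.thm12_4`} + COUNT-EC⁰** (E9's display, used on the all-additive rows only): the converse.
On a row `thm12_4` makes `I.H` f.g. torsion-free of rank one, so `(J.H2)_Γ` is finite (`finite_coinvariants_H2_of_iwasawaH2Data`)
of `p`-power order (`exists_natCard_eq_pow_of_module`); `φ` with `im φ = p^{v₀} ℤ_p` exists (`exists_kummerLog_range_eq`), rank one
gives a generator `P` modulo torsion, E11 gives `a` with `v₀ = a + v(log_ω P)`; COUNT-EC⁰ at `(P, φ, v₀)` and §2 (←).  Hence,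
modulo {GZK, `thm12_4`}, COUNT-H2 and COUNT-EC⁰ are EQUIVALENT on the all-additive rows. [cite: Kato2004Asterisque, Thm. 12.4
(p. 221), (14.9.3) (p. 240), §14.14 (p. 243), Lemma 14.15 and Prop. 14.16 (p. 244)] [cite: BlochKato1990, Ex. 3.11] -/
theorem countH2_of_gzk_of_thm12_4_of_countEC₀ (hGZK : rank_eq_analyticRank_of_analyticRank_le_one) (h12 : Kato2004.thm12_4)
    (hEC : ∀ (W : WeierstrassCurve ℚ) [W.IsElliptic] [W.IsGloballyMinimal] (p : ℕ) [Fact p.Prime],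
      letI : ContinuousSMul ℤ_[p] (W.tateModule p) := TateModule.continuousSMul_padicInt
      ∀ (κ : ZpExtension ℚ p) (γ : absoluteGaloisGroup ℚ), κ.IsCyclotomic → κ.IsTopGenerator γ →
        ∀ (I : IwasawaH1Data W p κ γ) (J : IwasawaH2Data W p κ γ I) (P : W.toAffine.Point)
          (φ : integralH1 (tateRep W p) p (κ.layerSubgroup 0) →ₗ[ℤ_[p]] ℚ_[p]) (v₀ : ℤ),
          W.analyticRank = 1 → p ≠ 2 → Addv W p → 0 ≤ padicValRat p W.j → ¬ p ∣ W.torsionOrder →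
          Finite W.sha →
          (∀ (Y : W.FineSelmerDualData κ γ⁻¹) (𝔮 : PrimeSpectrum (IwasawaAlgebra p)), 𝔮.asIdeal.height = 1 →
            Module.lengthAt (IwasawaAlgebra p) J.H2 𝔮 = Module.lengthAt (IwasawaAlgebra p) Y.X 𝔮) →
          (∀ Q : W.toAffine.Point, ∃ n : ℤ, IsOfFinAddOrder (Q - n • P)) →
          (∀ x : integralH1 (tateRep W p) p (κ.layerSubgroup 0),
            HasLocPKummerLog W p (layerZeroToTop W p κ (x : H1 (tateRep W p) (κ.layerSubgroup 0))) (φ x)) →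
          LinearMap.range φ = Submodule.span ℤ_[p] {((p : ℚ_[p]) ^ v₀)} →
          (padicValNat p (Nat.card (coinvariants p J.H2)) : ℤ) + v₀ =
            padicValNat p (Nat.card (AddCommGroup.primaryComponent W.sha p)) + padicValNat p W.tamagawaProduct +
              2 * (padicLogLocal W p
                (WeierstrassCurve.Affine.Point.map (W' := W.toAffine) (S := ℚ) (Algebra.ofId ℚ ℚ_[p]) P)).valuation) :
    ∀ (W : WeierstrassCurve ℚ) [W.IsElliptic] [W.IsGloballyMinimal] (p : ℕ) [Fact p.Prime],
      letI : ContinuousSMul ℤ_[p] (W.tateModule p) := TateModule.continuousSMul_padicInt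
      ∀ (κ : ZpExtension ℚ p) (γ : absoluteGaloisGroup ℚ), κ.IsCyclotomic → κ.IsTopGenerator γ →
        ∀ (I : IwasawaH1Data W p κ γ) (J : IwasawaH2Data W p κ γ I),
          W.analyticRank = 1 → p ≠ 2 → Addv W p → 0 ≤ padicValRat p W.j → ¬ p ∣ W.torsionOrder → Finite W.sha →
          (∀ v ∈ W.badPlaces (𝓞 ℚ), ((Rat.HeightOneSpectrum.primesEquiv v : Nat.Primes) : ℕ) ≠ p →
            W.HasAdditiveReductionAt v) →
          (∀ (Y : W.FineSelmerDualData κ γ⁻¹) (𝔮 : PrimeSpectrum (IwasawaAlgebra p)), 𝔮.asIdeal.height = 1 →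
            Module.lengthAt (IwasawaAlgebra p) J.H2 𝔮 = Module.lengthAt (IwasawaAlgebra p) Y.X 𝔮) →
          KatoH2CountAt W p (Nat.card (coinvariants p J.H2)) := by
  intro W _ _ p _
  letI : ContinuousSMul ℤ_[p] (W.tateModule p) := TateModule.continuousSMul_padicInt
  intro κ γ hκ hγ I J hr hp2 hadd hj htors hsha hall hpin
  obtain ⟨hmw, -⟩ := hGZK W (by rw [hr])
  have hrank : W.mordellWeilRank = 1 := by rw [hmw, hr]
  haveI := hsha
  have hsha' : Finite (AddCommGroup.primaryComponent W.sha p) := inferInstance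
  obtain ⟨hfg, ⟨htf, hrk⟩, -⟩ := h12 W p κ γ hκ hγ I
  haveI := hfg
  haveI := htf
  haveI : Nontrivial I.H := by
    by_contra hnt
    rw [not_nontrivial_iff_subsingleton] at hnt
    have h0 : Module.rank (IwasawaAlgebra p) I.H = 0 := rank_subsingleton' _ _
    rw [hrk] at h0
    exact one_ne_zero h0
  haveI := finite_coinvariants_H2_of_iwasawaH2Data W p J hrank hsha'
  -- a generator modulo torsion, its Kummer class, the functional `φ` and the lattice exponent `a`
  obtain ⟨P, hP₀⟩ := exists_generates_modTorsion_of_mordellWeilRank_eq_one W hrank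
  -- (§1's generator lemma carries the classical `DecidableEq` on `W(ℚ)`; `convert` re-bases it on the `ℚ` instance)
  have hP : ∀ Q : W.toAffine.Point, ∃ n : ℤ, IsOfFinAddOrder (Q - n • P) := fun Q => by
    obtain ⟨n, hn⟩ := hP₀ Q
    exact ⟨n, by convert hn⟩
  obtain ⟨x, hx⟩ := exists_forall_ofTopSubgroup_reduceH1Pk_eq_kummerMapTorsion W p (zsmul_pow_surjective W p) P
  obtain ⟨φ, v₀, hφ, -, -, -, hv₀⟩ := exists_kummerLog_range_eq W p J hrank hsha'
  obtain ⟨a, ha, hv₀a⟩ := exists_integralH1_eq_span_pow_smul_and_eq_add_valuation W p κ hrank hsha' htors hP hx φ hφ hv₀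
  obtain ⟨Q, hQp, hQadd, hQbad⟩ := exists_finset_badPlaces_ne W p hall
  have hec := hEC W p κ γ hκ hγ I J P φ v₀ hr hp2 hadd hj htors hsha hpin hP hφ hv₀
  rw [hv₀a] at hec
  exact (katoH2CountAt_iff_padicValNat_add_eq W p hp2 hadd hrank hsha' htors hP hx Q hQp hQadd hQbad ha
    (exists_natCard_eq_pow_of_module p (R := IwasawaAlgebra p) (M := coinvariants p J.H2))).mpr (by linarith)

end Displays

end Summit.BirchSwinnertonDyer.Rank1Residual.Additive.StrictCount

end
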